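import Mathlib
import HarnessLib

/-!
# Route `UniversalDetector`, crux `DetectorRigidity` (stmt-QuantumFields-26595) — the scalar heart of stub 1, proved

Ideator seat ym-idea-8 g2, LINE 4 of rung R2a. `Stmt_semigroupKill` (the XL stub of the lever's skeleton) reduces, after
Gaussian smearing in space, to a statement about ONE scalar function `φ(t) = ∫∫ e^{-‖x̄‖²} e^{-‖ȳ‖²} K(t, ȳ − x̄)` on the
half-line: slab reflection positivity of `K` makes the Hankel-type kernel `φ(s + s′)` positive semidefinite, `φ` is bounded on
`[T, ∞)` and continuous on `(0, ∞)`, and the vanishing detector pairing reads `∫∫ h(s) h(s′) φ(s + s′) ds ds′ = 0` with one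
profile `h ≥ 0`, `h ≢ 0`. **`oneProfileKill`**: these force `φ ≡ 0` on `(0, ∞)` — with NO Osterwalder–Schrader Hilbert space,
no semigroup and no spectral theorem: (i) 2 × 2 minors spread a zero of `φ` at `t` to `(t/2, ∞)`, hence to `(0, ∞)`;
(ii) if `φ` has no zero, the minors make `n ↦ φ(t₁ + n d)` ratio-monotone, so an increase `φ(t₂) > φ(t₁)` would grow
geometrically against the bound — `φ` is non-increasing; (iii) then the pairing is `≥ φ(2 t_b) (∫ h)² > 0`.
No summit, leg or spine crux is proved here.
-/

set_option autoImplicit false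

namespace Summit.QuantumFields.YangMills.Cruxes.DetectorRigidity

open MeasureTheory Set Filter

/-- Diagonal entries of a positive semidefinite semigroup kernel are non-negative. -/
theorem psd_diag_nonneg (φ : ℝ → ℝ)
    (hpsd : ∀ (n : ℕ) (s c : Fin n → ℝ), (∀ i, 0 < s i) → 0 ≤ ∑ i, ∑ j, c i * c j * φ (s i + s j))
    (p : ℝ) (hp : 0 < p) : 0 ≤ φ (p + p) := by
  have := hpsd 1 ![p] ![1] (by intro i; fin_cases i; simpa using hp)
  simpa using this

/-- The `2 × 2` minor of a positive semidefinite semigroup kernel. -/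
theorem psd_minor (φ : ℝ → ℝ)
    (hpsd : ∀ (n : ℕ) (s c : Fin n → ℝ), (∀ i, 0 < s i) → 0 ≤ ∑ i, ∑ j, c i * c j * φ (s i + s j))
    (p q : ℝ) (hp : 0 < p) (hq : 0 < q) : φ (p + q) ^ 2 ≤ φ (p + p) * φ (q + q) := by
  have hQ : ∀ x y : ℝ, 0 ≤ x * x * φ (p + p) + 2 * (x * y * φ (p + q)) + y * y * φ (q + q) := by
    intro x y
    have h := hpsd 2 ![p, q] ![x, y] (by intro i; fin_cases i <;> simp [hp, hq])
    simp only [Fin.sum_univ_two, Matrix.cons_val_zero, Matrix.cons_val_one] at h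
    rw [add_comm q p] at h
    linarith
  have ha : 0 ≤ φ (p + p) := psd_diag_nonneg φ hpsd p hp
  set a := φ (p + p) with ha_def
  set b := φ (p + q) with hb_def
  set c := φ (q + q) with hc_def
  rcases ha.lt_or_eq with hapos | hazero
  · have h := hQ (-b) a
    have h' : 0 ≤ a * (a * c - b ^ 2) := by nlinarith [h]
    have h'' : 0 ≤ a * c - b ^ 2 := by
      by_contra hneg
      push Not at hneg
      have : a * (a * c - b ^ 2) < 0 := mul_neg_of_pos_of_neg hapos hneg
      linarith
    nlinarith [h'']
  · -- a = 0 forces b = 0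
    have hb : b = 0 := by
      by_contra hb
      have h := hQ (-(c + 1) / (2 * b)) 1
      rw [← hazero] at h
      have : 2 * (-(c + 1) / (2 * b) * 1 * b) = -(c + 1) := by field_simp
      nlinarith [h, this]
    rw [hb, ← hazero]; simp

/-- A zero of `φ` at `t > 0` spreads to `(t/2, ∞)`. -/
theorem psd_zero_spread (φ : ℝ → ℝ)
    (hpsd : ∀ (n : ℕ) (s c : Fin n → ℝ), (∀ i, 0 < s i) → 0 ≤ ∑ i, ∑ j, c i * c j * φ (s i + s j))
    (t : ℝ) (ht : 0 < t) (h0 : φ t = 0) (u : ℝ) (hu : t / 2 < u) : φ u = 0 := by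
  have hq : 0 < u - t / 2 := by linarith
  have h := psd_minor φ hpsd (t / 2) (u - t / 2) (by linarith) hq
  have e1 : t / 2 + (u - t / 2) = u := by ring
  have e2 : t / 2 + t / 2 = t := by ring
  rw [e1, e2, h0, zero_mul] at h
  exact pow_eq_zero_iff (n := 2) (by norm_num) |>.mp (le_antisymm h (sq_nonneg _))

/-- Hence one zero on `(0, ∞)` forces `φ ≡ 0` on `(0, ∞)`. -/
theorem psd_zero_all (φ : ℝ → ℝ)
    (hpsd : ∀ (n : ℕ) (s c : Fin n → ℝ), (∀ i, 0 < s i) → 0 ≤ ∑ i, ∑ j, c i * c j * φ (s i + s j))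
    (t : ℝ) (ht : 0 < t) (h0 : φ t = 0) (u : ℝ) (hu : 0 < u) : φ u = 0 := by
  -- Q n : every zero `t` kills every `u` with `t < 2^n * u`
  have Q : ∀ n : ℕ, ∀ t : ℝ, 0 < t → φ t = 0 → ∀ u : ℝ, 0 < u → t < 2 ^ n * u → φ u = 0 := by
    intro n
    induction n with
    | zero =>
      intro t ht h0 u hu htu
      exact psd_zero_spread φ hpsd t ht h0 u (by simp at htu; linarith)
    | succ n ih =>
      intro t ht h0 u hu htu
      -- intermediate zero strictly between t/2 and 2^n u
      have hlt : t / 2 < 2 ^ n * u := by rw [pow_succ] at htu; linarith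
      set t₁ := (t / 2 + 2 ^ n * u) / 2 with ht₁
      have h1 : t / 2 < t₁ := by rw [ht₁]; linarith
      have h2 : t₁ < 2 ^ n * u := by rw [ht₁]; linarith
      have h3 : 0 < t₁ := by linarith
      exact ih t₁ h3 (psd_zero_spread φ hpsd t ht h0 t₁ h1) u hu h2
  obtain ⟨n, hn⟩ := pow_unbounded_of_one_lt (t / u) (by norm_num : (1 : ℝ) < 2)
  exact Q n t ht h0 u hu (by rwa [div_lt_iff₀ hu] at hn)

/-- A bounded positive semidefinite semigroup kernel without zeros is non-increasing on `(0, ∞)`. -/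
theorem psd_antitone (φ : ℝ → ℝ)
    (hpsd : ∀ (n : ℕ) (s c : Fin n → ℝ), (∀ i, 0 < s i) → 0 ≤ ∑ i, ∑ j, c i * c j * φ (s i + s j))
    (hbdd : ∀ T : ℝ, 0 < T → ∃ C : ℝ, ∀ t : ℝ, T ≤ t → |φ t| ≤ C)
    (hpos : ∀ u : ℝ, 0 < u → 0 < φ u)
    (t₁ t₂ : ℝ) (ht₁ : 0 < t₁) (h12 : t₁ ≤ t₂) : φ t₂ ≤ φ t₁ := by
  by_contra hlt
  push Not at hlt
  have hd : 0 < t₂ - t₁ := by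
    rcases h12.lt_or_eq with h | h
    · linarith
    · rw [h] at hlt; exact absurd hlt (lt_irrefl _)
  set d := t₂ - t₁ with hd_def
  set a : ℕ → ℝ := fun n => φ (t₁ + n * d) with ha
  have ha0 : a 0 = φ t₁ := by simp [ha]
  have ha1 : a 1 = φ t₂ := by simp [ha, hd_def]
  have hapos : ∀ n, 0 < a n := fun n => hpos _ (by positivity)
  -- minors along the progression: a (n+1)^2 ≤ a n * a (n+2)
  have hmin : ∀ n : ℕ, a (n + 1) ^ 2 ≤ a n * a (n + 2) := by
    intro n
    have h := psd_minor φ hpsd ((t₁ + n * d) / 2) ((t₁ + (n + 2 : ℕ) * d) / 2) (by positivity) (by positivity)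
    have e1 : (t₁ + n * d) / 2 + (t₁ + ((n + 2 : ℕ) : ℝ) * d) / 2 = t₁ + ((n + 1 : ℕ) : ℝ) * d := by
      push_cast; ring
    have e2 : (t₁ + n * d) / 2 + (t₁ + n * d) / 2 = t₁ + n * d := by ring
    have e3 : (t₁ + ((n + 2 : ℕ) : ℝ) * d) / 2 + (t₁ + ((n + 2 : ℕ) : ℝ) * d) / 2 = t₁ + ((n + 2 : ℕ) : ℝ) * d := by
      ring
    rw [e1, e2, e3] at h
    simpa [ha] using h
  set r := a 1 / a 0 with hr
  have hr1 : 1 < r := by rw [hr, ha0, ha1, one_lt_div (hpos t₁ ht₁)]; exact hlt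
  -- geometric growth
  have hstep : ∀ n : ℕ, r * a n ≤ a (n + 1) := by
    intro n
    induction n with
    | zero => rw [hr, div_mul_cancel₀ _ (hapos 0).ne']
    | succ n ih =>
      have h1 := hmin n
      have h2 := hapos n
      have h3 := hapos (n + 1)
      -- a n * a (n+2) ≥ a(n+1)^2 ≥ a(n+1) * (r * a n)
      have h4 : a (n + 1) * (r * a n) ≤ a n * a (n + 2) := by nlinarith
      have h5 : r * a (n + 1) * a n ≤ a (n + 2) * a n := by nlinarith
      exact le_of_mul_le_mul_right h5 h2
  have hgeom : ∀ n : ℕ, r ^ n * a 0 ≤ a n := by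
    intro n
    induction n with
    | zero => simp
    | succ n ih =>
      calc r ^ (n + 1) * a 0 = r * (r ^ n * a 0) := by ring
        _ ≤ r * a n := by exact mul_le_mul_of_nonneg_left ih (by linarith)
        _ ≤ a (n + 1) := hstep n
  obtain ⟨C, hC⟩ := hbdd t₁ ht₁
  have hbd : ∀ n : ℕ, a n ≤ C := fun n =>
    (le_abs_self _).trans (hC _ (by nlinarith [hd, (Nat.cast_nonneg n : (0 : ℝ) ≤ n)]))
  obtain ⟨n, hn⟩ := pow_unbounded_of_one_lt (C / a 0) hr1
  have : C < r ^ n * a 0 := by rwa [div_lt_iff₀ (hapos 0)] at hn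
  linarith [hgeom n, hbd n]

/-- **One-profile kill (scalar heart of `Stmt_semigroupKill`).** A function `φ` continuous on `(0,∞)`, bounded on every
`[T,∞)`, whose semigroup kernel `φ(s+s′)` is positive semidefinite, and which annihilates one non-negative, non-zero
continuous profile `h` supported in `[t_a,t_b] ⊂ (0,∞)` in the sense `∫∫ h(s)h(s′)φ(s+s′) = 0`, vanishes on `(0,∞)`. -/
theorem oneProfileKill (φ : ℝ → ℝ)
    (hcont : ContinuousOn φ (Set.Ioi 0))
    (hbdd : ∀ T : ℝ, 0 < T → ∃ C : ℝ, ∀ t : ℝ, T ≤ t → |φ t| ≤ C)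
    (hpsd : ∀ (n : ℕ) (s c : Fin n → ℝ), (∀ i, 0 < s i) → 0 ≤ ∑ i, ∑ j, c i * c j * φ (s i + s j))
    (h : ℝ → ℝ) (ta tb : ℝ) (hta : 0 < ta) (hh : Continuous h) (hh0 : ∀ t, 0 ≤ h t)
    (hsupp : tsupport h ⊆ Set.Icc ta tb) (hne : ∃ t, h t ≠ 0)
    (hvan : ∫ s, ∫ s', h s * h s' * φ (s + s') = 0) :
    ∀ t : ℝ, 0 < t → φ t = 0 := by
  by_contra hex
  push Not at hex
  obtain ⟨t₀, ht₀, hφt₀⟩ := hex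
  -- no zeros on `(0,∞)`, hence `φ > 0` there, hence `φ` is non-increasing there
  have hnz : ∀ u, 0 < u → φ u ≠ 0 := fun u hu h0 => hφt₀ (psd_zero_all φ hpsd u hu h0 t₀ ht₀)
  have hpos : ∀ u, 0 < u → 0 < φ u := by
    intro u hu
    have h1 := psd_diag_nonneg φ hpsd (u / 2) (by linarith)
    rw [add_halves] at h1
    exact lt_of_le_of_ne h1 (hnz u hu).symm
  have hanti := psd_antitone φ hpsd hbdd hpos
  -- the profile
  have hHc : HasCompactSupport h := isCompact_Icc.of_isClosed_subset (isClosed_tsupport h) hsupp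
  have hmem : ∀ s, h s ≠ 0 → s ∈ Set.Icc ta tb := fun s hs => hsupp (subset_tsupport h hs)
  obtain ⟨x₀, hx₀⟩ := hne
  have htb : ta ≤ tb := (hmem x₀ hx₀).1.trans (hmem x₀ hx₀).2
  have hIpos : 0 < ∫ s, h s := hh.integral_pos_of_hasCompactSupport_nonneg_nonzero hHc (fun t => hh0 t) hx₀
  -- a globally continuous modification of `φ` agreeing with it where the profile lives
  set ψ : ℝ → ℝ := fun t => φ (max t ta) with hψ
  have hψc : Continuous ψ :=
    hcont.comp_continuous (continuous_id.max continuous_const) fun t => lt_max_of_lt_right hta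
  have hI : ∀ s s', h s * h s' * φ (s + s') = h s * h s' * ψ (s + s') := by
    intro s s'
    by_cases hs : h s = 0
    · simp [hs]
    by_cases hs' : h s' = 0
    · simp [hs']
    have h1 := hmem s hs
    have h2 := hmem s' hs'
    have : max (s + s') ta = s + s' := max_eq_left (by linarith [h1.1, h2.1])
    simp only [hψ, this]
  have hvan' : ∫ s, ∫ s', h s * h s' * ψ (s + s') = 0 := by
    have e : (fun s => ∫ s', h s * h s' * φ (s + s')) = fun s => ∫ s', h s * h s' * ψ (s + s') := by
      funext s; congr 1; funext s'; exact hI s s'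
    rw [← e]; exact hvan
  -- the inner integral `J`
  set J : ℝ → ℝ := fun s => ∫ s', h s' * ψ (s + s') with hJ
  have hinner : ∀ s, ∫ s', h s * h s' * ψ (s + s') = h s * J s := by
    intro s
    rw [hJ, ← integral_const_mul]
    congr 1; funext s'; ring
  have hJc : Continuous J := by
    have e : J = fun s => ∫ s' in Set.Icc ta tb, h s' * ψ (s + s') := by
      funext s
      rw [hJ, setIntegral_eq_integral_of_forall_compl_eq_zero]
      intro s' hs'
      have : h s' = 0 := by
        by_contra hne'
        exact hs' (hmem s' hne')
      simp [this]
    rw [e]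
    exact continuous_parametric_integral_of_continuous
      (f := fun s s' => h s' * ψ (s + s'))
      ((hh.comp continuous_snd).mul (hψc.comp (continuous_fst.add continuous_snd))) isCompact_Icc
  -- lower bound on `J` at profile points
  set c := φ (tb + tb) with hc
  have hcpos : 0 < c := hpos _ (by linarith)
  set I := ∫ s, h s with hIdef
  have hJge : ∀ s, h s ≠ 0 → I * c ≤ J s := by
    intro s hs
    have h1 := hmem s hs
    have hint1 : Integrable (fun s' => h s' * c) :=
      (hh.mul continuous_const).integrable_of_hasCompactSupport hHc.mul_right
    have hint2 : Integrable (fun s' => h s' * ψ (s + s')) :=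
      (hh.mul (hψc.comp (continuous_const.add continuous_id))).integrable_of_hasCompactSupport hHc.mul_right
    have hle : (fun s' => h s' * c) ≤ fun s' => h s' * ψ (s + s') := by
      intro s'
      by_cases hs' : h s' = 0
      · simp [hs']
      have h2 := hmem s' hs'
      have hmax : max (s + s') ta = s + s' := max_eq_left (by linarith [h1.1, h2.1])
      have hmono : φ (tb + tb) ≤ φ (s + s') := hanti (s + s') (tb + tb) (by linarith [h1.1, h2.1]) (by linarith [h1.2, h2.2])
      simp only [hψ, hmax]
      exact mul_le_mul_of_nonneg_left hmono (hh0 s')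
    have := integral_mono hint1 hint2 hle
    rw [integral_mul_const] at this
    simpa [hIdef, hc, mul_comm] using this
  -- outer integral: `0 = ∫ h·J ≥ I·(I·c) > 0`
  have hint3 : Integrable (fun s => h s * J s) := (hh.mul hJc).integrable_of_hasCompactSupport hHc.mul_right
  have hint4 : Integrable (fun s => h s * (I * c)) := (hh.mul continuous_const).integrable_of_hasCompactSupport hHc.mul_right
  have hle2 : (fun s => h s * (I * c)) ≤ fun s => h s * J s := by
    intro s
    by_cases hs : h s = 0
    · simp [hs]
    exact mul_le_mul_of_nonneg_left (hJge s hs) (hh0 s)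
  have hge := integral_mono hint4 hint3 hle2
  rw [integral_mul_const] at hge
  have h0 : ∫ s, h s * J s = 0 := by
    have e : (fun s => h s * J s) = fun s => ∫ s', h s * h s' * ψ (s + s') := by funext s; exact (hinner s).symm
    rw [e]; exact hvan'
  have : 0 < I * (I * c) := by positivity
  linarith

end Summit.QuantumFields.YangMills.Cruxes.DetectorRigidity
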